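import Mathlib
import Literature.NumberTheory.Transcendental.ZagierDilogarithmConjecture
import Literature.NumberTheory.Transcendental.BlochWignerDilogarithm
import Literature.NumberTheory.Transcendental.BlochWignerDilogarithmProofs
import Summits.KontsevichZagierPeriods.KontsevichZagierPeriods.Theorems.HyperbolicBlochZagierDilogarithmConjectureStubCyclotomicTwists
import HarnessLib

/-!
# `ZagierDilogarithmConjecture` (stmt-KontsevichZagierPeriods-10550) — line `kummer-clausen-linearisation`
(reshape c5, "the cyclotomic tower and the abelian sector"), stub `stub_cyclotomicTorsionDescent`

**Galois descent on the roots of unity without Borel, torsion form.** Let `ζ_N = exp(2πi/N)` (`N ≥ 1`),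
`D = blochWignerDilog` the Bloch–Wigner dilogarithm and `C = ⟨dilogRelators⟩ ⊆ ℤ[ℂ]` the relator group.
Assume

* FOLDING: every `x = Σ_{c mod N} m_c [ζ_N^c]` has a positive multiple `M • x` congruent modulo `C` to a
  combination `y = Σ_a b_a [ζ_N^a]` supported on the units `a` of the open upper half
  (`0 < a < N/2`);
* EQ-ZERO-OF-TWISTS: an upper-half-unit-supported `b` all of whose Galois-twisted volumes
  `Σ_c b_c D(ζ_N^{ac})` (`a` a unit) vanish is `0`.

Then: if all Galois-twisted volumes `Σ_c m_c D(ζ_N^{ac})` of `x` vanish, some positive multiple of `x`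
lies in `C`.

Proof. Fold: `M • x − y ∈ C` with `y = Σ_a b_a [ζ_N^a]`, `b` supported on upper-half units. Now
`M • x − y = Σ_c (M m_c − b_c) [ζ_N^c]`, so by the (proved, in-tree) stub `stub_cyclotomicTwists` every
twisted volume of `M • x − y` vanishes: `M · Σ_c m_c D(ζ_N^{ac}) − Σ_c b_c D(ζ_N^{ac}) = 0`. The first sum
is `0` by hypothesis, hence all twisted volumes of `y` vanish, hence `b = 0` (EQ-ZERO-OF-TWISTS), `y = 0`
and `M • x = (M • x − y) ∈ C`.

Sorry-free; axioms ⊆ {propext, Classical.choice, Quot.sound}.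

## References

* W. D. Neumann, *Hilbert's 3rd problem and invariants of 3-manifolds*, Geom. Topol. Monogr. 1
  (1998), §2.1 (the relator group, Galois action on the Bloch group). [Neumann1998]
* D. Zagier, *The dilogarithm function*, in: Frontiers in Number Theory, Physics, and Geometry II
  (2007), Ch. I §§3–4. [Zagier2007Dilogarithm]
-/

noncomputable section

open scoped BigOperators ComplexConjugate
open Literature.NumberTheory.Transcendental

namespace Summit.KontsevichZagierPeriods.HyperbolicBloch.ZagierDilogarithmCyclotomic

/-! ### Two bookkeeping identities -/

/-- `M • Σ_c m_c • F c − Σ_c b_c • F c = Σ_c (M m_c − b_c) • F c` in an additive commutative group.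
[folklore] -/
theorem nsmul_sum_zsmul_sub_sum_zsmul {ι A : Type*} [Fintype ι] [AddCommGroup A] (M : ℕ)
    (m b : ι → ℤ) (F : ι → A) :
    M • ∑ c, m c • F c - ∑ c, b c • F c = ∑ c, ((M : ℤ) * m c - b c) • F c := by
  rw [← natCast_zsmul, Finset.smul_sum, ← Finset.sum_sub_distrib]
  exact Finset.sum_congr rfl fun c _ => by rw [sub_smul, mul_smul]

/-- `Σ_c (M m_c − b_c) · v c = M · Σ_c m_c · v c − Σ_c b_c · v c` over `ℝ` (casts from `ℤ`).
[folklore] -/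
theorem sum_cast_mul_sub_mul {ι : Type*} [Fintype ι] (M : ℕ) (m b : ι → ℤ) (v : ι → ℝ) :
    ∑ c, (((M : ℤ) * m c - b c : ℤ) : ℝ) * v c =
      (M : ℝ) * ∑ c, (m c : ℝ) * v c - ∑ c, (b c : ℝ) * v c := by
  rw [Finset.mul_sum, ← Finset.sum_sub_distrib]
  exact Finset.sum_congr rfl fun c _ => by push_cast; ring

/-! ### The stub -/

/-- **Stub `stub_cyclotomicTorsionDescent` (Galois descent on the roots of unity WITHOUT Borel, torsion
form).** Given folding (every cyclotomic combination has a positive multiple congruent modulo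
`⟨dilogRelators⟩` to one supported on the units of the open upper half) and `stub_eqZeroOfTwists` (such
a primitive upper-half combination with all Galois-twisted volumes zero is zero): if all Galois-twisted
volumes `Σ_c m_c D(ζ_N^{ac})` (`a` a unit) of `x = Σ_c m_c[ζ_N^c]` vanish, then a positive multiple of
`x` lies in `⟨dilogRelators⟩`. Fold `M • x ≡ y`; the twisted volumes of `M • x − y ∈ ⟨dilogRelators⟩`
vanish (`stub_cyclotomicTwists`), hence those of `y`; so `y = 0` and `M • x ∈ ⟨dilogRelators⟩`.
[cite: Neumann1998, §2.1] -/
theorem stub_cyclotomicTorsionDescent :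
    (∀ (N : ℕ) [NeZero N] (m : ZMod N → ℤ), ∃ M : ℕ, 0 < M ∧ ∃ b : ZMod N → ℤ,
      (∀ a, b a ≠ 0 → IsUnit a ∧ 0 < a.val ∧ 2 * a.val < N) ∧
      (M • ∑ c : ZMod N, m c • FreeAbelianGroup.of (Complex.exp (2 * Real.pi * Complex.I / N) ^ c.val) -
        ∑ a : ZMod N, b a • FreeAbelianGroup.of (Complex.exp (2 * Real.pi * Complex.I / N) ^ a.val)) ∈
        AddSubgroup.closure dilogRelators) →
    (∀ (N : ℕ) [NeZero N] (m : ZMod N → ℤ), (∀ c, m c ≠ 0 → IsUnit c ∧ 0 < c.val ∧ 2 * c.val < N) →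
      (∀ a : (ZMod N)ˣ, ∑ c : ZMod N, (m c : ℝ) *
          blochWignerDilog (Complex.exp (2 * Real.pi * Complex.I / N) ^ ((a : ZMod N) * c).val) = 0) →
        ∀ c, m c = 0) →
    ∀ (N : ℕ) [NeZero N] (m : ZMod N → ℤ),
      (∀ a : (ZMod N)ˣ, ∑ c : ZMod N, (m c : ℝ) *
          blochWignerDilog (Complex.exp (2 * Real.pi * Complex.I / N) ^ ((a : ZMod N) * c).val) = 0) →
        ∃ M : ℕ, 0 < M ∧
          M • ∑ c : ZMod N, m c • FreeAbelianGroup.of (Complex.exp (2 * Real.pi * Complex.I / N) ^ c.val) ∈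
            AddSubgroup.closure dilogRelators := by
  intro hfold htw0 N _ m htw
  -- fold: `M • x - y ∈ C`, `y = Σ_a b_a [ζ^a]`, `b` supported on the units of the open upper half
  obtain ⟨M, hM, b, hb, hmem⟩ := hfold N m
  -- the twisted volumes of `M • x - y = Σ_c (M m_c - b_c) [ζ^c]` vanish (`stub_cyclotomicTwists`)
  have hT := stub_cyclotomicTwists N (fun c => (M : ℤ) * m c - b c)
    (by rw [← nsmul_sum_zsmul_sub_sum_zsmul]; exact hmem)
  -- hence so do those of `y`, so `b = 0`
  have hb0 : ∀ c, b c = 0 := by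
    refine htw0 N b hb fun a => ?_
    have h := hT a
    rw [sum_cast_mul_sub_mul, htw a, mul_zero, zero_sub, neg_eq_zero] at h
    exact h
  -- and `M • x = M • x - y ∈ C`
  have hy : ∑ a : ZMod N, b a • FreeAbelianGroup.of (Complex.exp (2 * Real.pi * Complex.I / N) ^ a.val) =
      0 :=
    Finset.sum_eq_zero fun a _ => by rw [hb0 a, zero_smul]
  rw [hy, sub_zero] at hmem
  exact ⟨M, hM, hmem⟩

end Summit.KontsevichZagierPeriods.HyperbolicBloch.ZagierDilogarithmCyclotomic

end
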